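import Mathlib
import Summits.KontsevichZagierPeriods.Zeta5Search.WedgeDictionaryQuadratic
import HarnessLib

/-!
# The wedge-square dictionary on its FULL region (the planners' Conjecture 2 verbatim) and its relation to `wedgeDictionary`

Cell `pub-zeta5` (HONEST FRAMING: systematic search; no irrationality claim unless certified), typer seat
generation 3.  OUR work (Summit side).  `WedgeDictionary.wedgeDictionary` was typed on the region of the planners'
Lean staging (`0 ≤ 2b_i ≤ b₀+1`, partner with `2(b_j+1) ≤ b₀+1`).  The planners' `DICTIONARY.md` §2 states
Conjecture 2 on the WIDER region

  `Converges a`,  `b_j(a) ≥ 0 (j = 1,…,7)`,  `d(b(a)) ≥ 0`,  ANY partner `j ∈ [1,7]`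

(evidence E1 there: all 3397 lattice points `a ∈ {1,2,3}⁸` of this region, exact).  On this region `b_j ≤ b₀` is
automatic (`bOfA_le_of_nonneg`: `b₀ − b₆ = b₅ + a₆`, `b₀ − b₇ = b₆ + a₇`, …), so every theorem of the dictionary layer
applies (`vwp_decomposition`, Lemma 1, `wedgeQ_eq_quadM3`).  This file types the wide conjecture
(`wedgeDictionaryFull`, INTERNALLY MINTED, `@[conjecture]`), proves `wedgeDictionaryFull → wedgeDictionary`, and
restates its `Q`-part in the j-free form `Q(a) = ρ(a)·M₃(b(a))`.
-/

noncomputable section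

open Finset

namespace Summit.KontsevichZagierPeriods.Zeta5Search.WedgeDictionary

open Summit.KontsevichZagierPeriods.Zeta5Search.DualSeries
open Literature.NumberTheory.Irrationality.BrownZudilin2022 (vwpDual bOfA Converges cellularIntegral QOf
  convergenceForms)
open Literature.NumberTheory.Transcendental (zetaValue)

/-- **CONJECTURE 2 of the planners on its full region (INTERNALLY MINTED — verified instances only, DICTIONARY.md §2–3).**
For `a` with `Converges a`, `b_j(a) ≥ 0` (`j = 1,…,7`) and `d(b(a)) ≥ 0`, and ANY partner `j ∈ [1,7]`, writing
`b = b(a)`, `b′ = b + e_j`, `ρ = rhoOf a`: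
`Q(a) = ρ·(U(b)W(b′) − U(b′)W(b))` and `I(a) = 2ρ·[(W(b′) − 2ζ(2)U(b′))·F̃₇(b) − (W(b) − 2ζ(2)U(b))·F̃₇(b′)]`. -/
@[conjecture] def wedgeDictionaryFull : Prop :=
  ∀ (a : Fin 8 → ℤ) (j : ℕ), j ∈ Icc 1 7 → Converges a → (∀ i ∈ Icc 1 7, 0 ≤ bOfA a i) → 0 ≤ dOf (bOfA a) →
    let b := bOfA a
    let b' := Function.update b j (b j + 1)
    (QOf a : ℚ) = rhoOf a * (coeffU b * coeffW b' - coeffU b' * coeffW b) ∧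
    cellularIntegral a =
      2 * (rhoOf a : ℝ) *
        (((coeffW b' : ℝ) - 2 * zetaValue 2 * coeffU b') * vwpDual 7 b -
          ((coeffW b : ℝ) - 2 * zetaValue 2 * coeffU b) * vwpDual 7 b')

/-- The full-region conjecture implies the typed one (whose region is contained in the full region). -/
theorem wedgeDictionary_of_full (h : wedgeDictionaryFull) : wedgeDictionary := by
  intro a j hj hconv hreg hd _
  exact h a j hj hconv (fun i hi => (hreg i hi).1) hd

/-! ### On the full region every `b_j ≤ b₀`, so the dictionary layer applies -/

/-- For convergent `a` (so `a₁,…,a₇ ≥ 0` and `a₄+a₈−a₂ ≥ 0`, forms of (3)) with `b_j(a) ≥ 0`: `b_j(a) ≤ b₀(a)` for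
`j = 1,…,7` (`b₀−b₁ = a₁+a₂`, `b₀−b₂ = a₃+a₄`, `b₀−b₃ = a₂+a₃`, `b₀−b₄ = a₄+a₅`, `b₀−b₅ = (a₄+a₈−a₂)+a₂`, `b₀−b₆ = b₅+a₆`,
`b₀−b₇ = b₆+a₇`). -/
theorem bOfA_le_of_nonneg (a : Fin 8 → ℤ) (hconv : Converges a) (hnn : ∀ i ∈ Icc 1 7, 0 ≤ bOfA a i) :
    ∀ i ∈ Icc 1 7, bOfA a i ≤ bOfA a 0 := by
  have hf : ∀ x ∈ convergenceForms a, 0 ≤ x := hconv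
  have ha0 : 0 ≤ a 0 := hf _ (by simp [convergenceForms])
  have ha1 : 0 ≤ a 1 := hf _ (by simp [convergenceForms])
  have ha2 : 0 ≤ a 2 := hf _ (by simp [convergenceForms])
  have ha3 : 0 ≤ a 3 := hf _ (by simp [convergenceForms])
  have ha4 : 0 ≤ a 4 := hf _ (by simp [convergenceForms])
  have ha5 : 0 ≤ a 5 := hf _ (by simp [convergenceForms])
  have ha6 : 0 ≤ a 6 := hf _ (by simp [convergenceForms])
  have h37 : 0 ≤ a 3 + a 7 - a 1 := hf _ (by simp [convergenceForms])
  have h5 := hnn 5 (by simp)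
  have h6 := hnn 6 (by simp)
  simp only [bOfA] at h5 h6
  intro i hi
  obtain ⟨hi1, hi7⟩ := mem_Icc.1 hi
  interval_cases i <;> simp only [bOfA] <;> linarith

/-- On the full region: `b(a)` is in the box, with the partner bound, for every `j ∈ [1,7]`. -/
theorem inBox_of_full (a : Fin 8 → ℤ) (hconv : Converges a) (hnn : ∀ i ∈ Icc 1 7, 0 ≤ bOfA a i) :
    InBox (bOfA a) ∧ ∀ j ∈ Icc 1 7, bOfA a j ≤ bOfA a 0 := by
  have hle := bOfA_le_of_nonneg a hconv hnn
  have h0 : 0 ≤ bOfA a 0 := le_trans (hnn 1 (by simp)) (hle 1 (by simp))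
  refine ⟨⟨h0, fun i hi => ?_⟩, hle⟩
  have hi' : i + 1 ∈ Icc 1 7 := by have := mem_range.1 hi; exact mem_Icc.2 ⟨by omega, by omega⟩
  exact ⟨hnn _ hi', by linarith [hle _ hi']⟩

/-- **The `Q`-part of the full conjecture in j-free form**: on the full region, for any partner `j`,
`(Q(a) = ρ(UW′ − U′W)) ↔ (Q(a) = ρ(a)·M₃(b(a)))`. -/
theorem Q_part_full_iff_quadM3 (a : Fin 8 → ℤ) {j : ℕ} (hj : j ∈ Icc 1 7) (hconv : Converges a)
    (hnn : ∀ i ∈ Icc 1 7, 0 ≤ bOfA a i) (hd : 0 ≤ dOf (bOfA a)) :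
    ((QOf a : ℚ) = rhoOf a * (coeffU (bOfA a) * coeffW (Function.update (bOfA a) j (bOfA a j + 1)) -
        coeffU (Function.update (bOfA a) j (bOfA a j + 1)) * coeffW (bOfA a))) ↔
      (QOf a : ℚ) = rhoOf a * quadM3 (bOfA a) := by
  obtain ⟨hbox, hle⟩ := inBox_of_full a hconv hnn
  rw [wedgeQ_eq_quadM3' (bOfA a) hbox hd hj (hle j hj)]

/-- Hence `wedgeDictionaryFull` implies `Q(a) = ρ(a)·M₃(b(a))` on the full region. -/
theorem Q_eq_rho_mul_quadM3_of_full (h : wedgeDictionaryFull) (a : Fin 8 → ℤ) (hconv : Converges a)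
    (hnn : ∀ i ∈ Icc 1 7, 0 ≤ bOfA a i) (hd : 0 ≤ dOf (bOfA a)) :
    (QOf a : ℚ) = rhoOf a * quadM3 (bOfA a) :=
  (Q_part_full_iff_quadM3 a (show 1 ∈ Icc 1 7 by simp) hconv hnn hd).1 (h a 1 (by simp) hconv hnn hd).1

/-- On the full region the decomposition theorem gives `F̃₇(b(a)) = Uζ(5) + Wζ(3) − V` (canonical coefficients). -/
theorem vwpDual_seven_eq_of_full (a : Fin 8 → ℤ) (hconv : Converges a) (hnn : ∀ i ∈ Icc 1 7, 0 ≤ bOfA a i)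
    (hd : 0 ≤ dOf (bOfA a)) :
    vwpDual 7 (bOfA a) =
      (coeffU (bOfA a) : ℝ) * zetaValue 5 + (coeffW (bOfA a) : ℝ) * zetaValue 3 - (coeffV (bOfA a) : ℝ) :=
  (vwp_decomposition (bOfA a) (inBox_of_full a hconv hnn).1 (sum_le_of_dOf _ hd)).2

end Summit.KontsevichZagierPeriods.Zeta5Search.WedgeDictionary
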